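import Mathlib
import HarnessLib
import Literature.Geometry.DiscreteGeometry.LayerPropagation

/-!
# Rigidity of sub-configurations of the FCC pattern: a contact triangle or a square corner
# determines the whole cuboctahedron

Route `BrittleRungDescent`, support item `SoftLayerPropagation` (stmt-AtomisticToContinuum-9210),
helper file (η = 0, vocabulary of `FejesTothKissingTwelve.lean` / `KissingRigidity.lean`: shells on
`S²(2)`, contact distance `2`, the enumerated reference configuration `fccRef`).

The local (finite-ball) form of Hales's layer propagation meets centres whose FCC shell is known to
CONTAIN a few points of an already reconstructed cuboctahedron; these lemmas conclude that the
shell IS that cuboctahedron: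

* `fccTab_coords_triangle` / `fccTab_of_coords_triangle` (`decide` on the integer table): in the
  basis formed by any ordered contact triangle of the cuboctahedron, the twelve vertices have one
  and the same list of integer coordinate triples (the ordered contact triangles form one orbit of
  the symmetry group, which acts freely on them); likewise `fccTab_coords_corner` /
  `fccTab_of_coords_corner` for an ordered square corner `(x; y, z)` (`x ~ y`, `x ~ z`, `y ⊥ z`);
* `eq_of_isArrangedIn_fcc_of_triangle` — **two FCC-arranged sets sharing a contact triangle are
  equal**; `eq_of_isArrangedIn_fcc_of_corner` — the same for a shared square corner.

All statements are elementary ([folklore]).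
-/

noncomputable section

namespace Summit.AtomisticToContinuum.Crystallization.Theorems

open Literature.Geometry.DiscreteGeometry Literature.MathematicalPhysics.StatisticalMechanics
open RealInnerProductSpace

/-! ### Integer coordinates in a contact triangle and in a square corner (`decide`) -/

/-- **Coordinates in a contact triangle.** For every ordered contact triangle `(i, j, k)` of the
cuboctahedron, every vertex is `a tᵢ + b tⱼ + c tₖ` for one of twelve fixed integer triples
`(a, b, c)`. [folklore] -/
theorem fccTab_coords_triangle :
    ∀ i j k : Fin 12, fccAdj i j → fccAdj i k → fccAdj j k → ∀ m : Fin 12,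
      ∃ t ∈ ([((1 : ℤ), (0 : ℤ), (0 : ℤ)), (0, 1, -1), (0, -1, 1), (-1, 0, 0), (0, 1, 0), (1, 0, -1),
        (-1, 0, 1), (0, -1, 0), (0, 0, 1), (1, -1, 0), (-1, 1, 0), (0, 0, -1)] : List (ℤ × ℤ × ℤ)),
        fccTab m = t.1 • fccTab i + t.2.1 • fccTab j + t.2.2 • fccTab k := by
  decide

/-- **Conversely**, for every ordered contact triangle each of the twelve triples is the
coordinate triple of a vertex. [folklore] -/
theorem fccTab_of_coords_triangle :
    ∀ i j k : Fin 12, fccAdj i j → fccAdj i k → fccAdj j k →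
      ∀ t ∈ ([((1 : ℤ), (0 : ℤ), (0 : ℤ)), (0, 1, -1), (0, -1, 1), (-1, 0, 0), (0, 1, 0), (1, 0, -1),
        (-1, 0, 1), (0, -1, 0), (0, 0, 1), (1, -1, 0), (-1, 1, 0), (0, 0, -1)] : List (ℤ × ℤ × ℤ)),
        ∃ m : Fin 12, fccTab m = t.1 • fccTab i + t.2.1 • fccTab j + t.2.2 • fccTab k := by
  decide

/-- **Coordinates in a square corner** `(i; j, k)`: `i ~ j`, `i ~ k`, `|tⱼ − tₖ|² = 4` (the two
neighbours `j, k` of `i` span a square face with `i`). [folklore] -/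
theorem fccTab_coords_corner :
    ∀ i j k : Fin 12, fccAdj i j → fccAdj i k → sqNormInt (fccTab j - fccTab k) = 4 → ∀ m : Fin 12,
      ∃ t ∈ ([((1 : ℤ), (0 : ℤ), (0 : ℤ)), (-1, 1, 1), (1, -1, -1), (-1, 0, 0), (0, 1, 0), (0, 0, 1),
        (0, 0, -1), (0, -1, 0), (1, 0, -1), (1, -1, 0), (-1, 1, 0), (-1, 0, 1)] : List (ℤ × ℤ × ℤ)),
        fccTab m = t.1 • fccTab i + t.2.1 • fccTab j + t.2.2 • fccTab k := by
  decide

/-- **Conversely** for a square corner. [folklore] -/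
theorem fccTab_of_coords_corner :
    ∀ i j k : Fin 12, fccAdj i j → fccAdj i k → sqNormInt (fccTab j - fccTab k) = 4 →
      ∀ t ∈ ([((1 : ℤ), (0 : ℤ), (0 : ℤ)), (-1, 1, 1), (1, -1, -1), (-1, 0, 0), (0, 1, 0), (0, 0, 1),
        (0, 0, -1), (0, -1, 0), (1, 0, -1), (1, -1, 0), (-1, 1, 0), (-1, 0, 1)] : List (ℤ × ℤ × ℤ)),
        ∃ m : Fin 12, fccTab m = t.1 • fccTab i + t.2.1 • fccTab j + t.2.2 • fccTab k := by
  decide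

/-! ### Transfer to the reference configuration -/

/-- `refPt` of an integer combination of three table vectors. [folklore] -/
theorem refPt_combo (N : ℕ) (a b c : ℤ) (u v w : Fin 3 → ℤ) :
    refPt N (a • u + b • v + c • w) = (a : ℝ) • refPt N u + (b : ℝ) • refPt N v + (c : ℝ) • refPt N w := by
  rw [refPt_add, refPt_add, refPt_intSmul, refPt_intSmul, refPt_intSmul]

/-- Squared distance of two FCC reference points: `2 |tᵢ − tⱼ|²`. [folklore] -/
theorem dist_fccRef_sq (i j : Fin 12) :
    dist (fccRef i) (fccRef j) ^ 2 = 2 * (sqNormInt (fccTab i - fccTab j) : ℝ) := by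
  have h0 : (0 : ℝ) ≤ (sqNormInt (fccTab i - fccTab j) : ℝ) := by
    have : (0 : ℤ) ≤ sqNormInt (fccTab i - fccTab j) := by unfold sqNormInt; positivity
    exact_mod_cast this
  rw [show fccRef i = refPt 2 (fccTab i) from rfl, show fccRef j = refPt 2 (fccTab j) from rfl, refPt,
    refPt, dist_two_smul_scaled, mul_pow, mul_pow, Real.sq_sqrt h0, inv_pow,
    Real.sq_sqrt (by norm_num : (0 : ℝ) ≤ (2 : ℕ))]
  push_cast
  ring

/-- In a moved FCC reference configuration, `dist = 2` iff the table vectors are adjacent.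
[folklore] -/
theorem dist_map_fccRef_eq_two_iff (A : EuclideanSpace ℝ (Fin 3) →ₗᵢ[ℝ] EuclideanSpace ℝ (Fin 3))
    (i j : Fin 12) : dist (A (fccRef i)) (A (fccRef j)) = 2 ↔ fccAdj i j :=
  dist_map_refPt_eq_two_iff two_ne_zero _ _

/-- In a moved FCC reference configuration, `dist² = 8` iff `|tᵢ − tⱼ|² = 4`. [folklore] -/
theorem dist_map_fccRef_sq_eq_eight_iff (A : EuclideanSpace ℝ (Fin 3) →ₗᵢ[ℝ] EuclideanSpace ℝ (Fin 3))
    (i j : Fin 12) : dist (A (fccRef i)) (A (fccRef j)) ^ 2 = 8 ↔ sqNormInt (fccTab i - fccTab j) = 4 := by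
  rw [A.dist_map, dist_fccRef_sq]
  constructor
  · intro h
    have : (sqNormInt (fccTab i - fccTab j) : ℝ) = 4 := by linarith
    exact_mod_cast this
  · intro h; rw [h]; norm_num

section Transfer

variable {A B : EuclideanSpace ℝ (Fin 3) →ₗᵢ[ℝ] EuclideanSpace ℝ (Fin 3)}

/-- **A shared contact triangle forces inclusion** of moved reference configurations. [folklore] -/
theorem range_fccRef_subset_of_triangle {i j k i' j' k' : Fin 12}
    (hij : fccAdj i j) (hik : fccAdj i k) (hjk : fccAdj j k)
    (hij' : fccAdj i' j') (hik' : fccAdj i' k') (hjk' : fccAdj j' k')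
    (hi : A (fccRef i) = B (fccRef i')) (hj : A (fccRef j) = B (fccRef j'))
    (hk : A (fccRef k) = B (fccRef k')) :
    Set.range (fun m => A (fccRef m)) ⊆ Set.range (fun m => B (fccRef m)) := by
  rintro _ ⟨m, rfl⟩
  obtain ⟨t, ht, hm⟩ := fccTab_coords_triangle i j k hij hik hjk m
  obtain ⟨m', hm'⟩ := fccTab_of_coords_triangle i' j' k' hij' hik' hjk' t ht
  refine ⟨m', ?_⟩
  have e1 : fccRef m = (t.1 : ℝ) • fccRef i + (t.2.1 : ℝ) • fccRef j + (t.2.2 : ℝ) • fccRef k := by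
    show refPt 2 (fccTab m) = _; rw [hm, refPt_combo]
  have e2 : fccRef m' = (t.1 : ℝ) • fccRef i' + (t.2.1 : ℝ) • fccRef j' + (t.2.2 : ℝ) • fccRef k' := by
    show refPt 2 (fccTab m') = _; rw [hm', refPt_combo]
  simp only [e1, e2, map_add, map_smul, hi, hj, hk]

/-- **A shared square corner forces inclusion** of moved reference configurations. [folklore] -/
theorem range_fccRef_subset_of_corner {i j k i' j' k' : Fin 12}
    (hij : fccAdj i j) (hik : fccAdj i k) (hjk : sqNormInt (fccTab j - fccTab k) = 4)
    (hij' : fccAdj i' j') (hik' : fccAdj i' k') (hjk' : sqNormInt (fccTab j' - fccTab k') = 4)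
    (hi : A (fccRef i) = B (fccRef i')) (hj : A (fccRef j) = B (fccRef j'))
    (hk : A (fccRef k) = B (fccRef k')) :
    Set.range (fun m => A (fccRef m)) ⊆ Set.range (fun m => B (fccRef m)) := by
  rintro _ ⟨m, rfl⟩
  obtain ⟨t, ht, hm⟩ := fccTab_coords_corner i j k hij hik hjk m
  obtain ⟨m', hm'⟩ := fccTab_of_coords_corner i' j' k' hij' hik' hjk' t ht
  refine ⟨m', ?_⟩
  have e1 : fccRef m = (t.1 : ℝ) • fccRef i + (t.2.1 : ℝ) • fccRef j + (t.2.2 : ℝ) • fccRef k := by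
    show refPt 2 (fccTab m) = _; rw [hm, refPt_combo]
  have e2 : fccRef m' = (t.1 : ℝ) • fccRef i' + (t.2.1 : ℝ) • fccRef j' + (t.2.2 : ℝ) • fccRef k' := by
    show refPt 2 (fccTab m') = _; rw [hm', refPt_combo]
  simp only [e1, e2, map_add, map_smul, hi, hj, hk]

end Transfer

/-! ### Two FCC-arranged sets sharing a triangle, or a square corner, coincide -/

/-- **Two FCC-arranged sets sharing a contact triangle are equal**: if `T₁, T₂` are both congruent
to the cuboctahedron `2 · fccKissingPattern` in `S²(2)` and contain three points `x, y, z` pairwise at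
distance `2`, then `T₁ = T₂` (every vertex of the cuboctahedron is an integer combination of the
vertices of any of its contact triangles, with coefficients independent of the triangle).
[folklore] -/
theorem eq_of_isArrangedIn_fcc_of_triangle {T₁ T₂ : Set (EuclideanSpace ℝ (Fin 3))}
    (h₁ : IsArrangedIn T₁ fccKissingPattern) (h₂ : IsArrangedIn T₂ fccKissingPattern)
    {x y z : EuclideanSpace ℝ (Fin 3)} (hx₁ : x ∈ T₁) (hy₁ : y ∈ T₁) (hz₁ : z ∈ T₁)
    (hx₂ : x ∈ T₂) (hy₂ : y ∈ T₂) (hz₂ : z ∈ T₂)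
    (hxy : dist x y = 2) (hxz : dist x z = 2) (hyz : dist y z = 2) : T₁ = T₂ := by
  obtain ⟨A, rfl⟩ := isArrangedIn_fcc_iff_range.1 h₁
  obtain ⟨B, rfl⟩ := isArrangedIn_fcc_iff_range.1 h₂
  obtain ⟨i, rfl⟩ := hx₁
  obtain ⟨j, rfl⟩ := hy₁
  obtain ⟨k, rfl⟩ := hz₁
  obtain ⟨i', hi'⟩ := hx₂
  obtain ⟨j', hj'⟩ := hy₂
  obtain ⟨k', hk'⟩ := hz₂
  have hij : fccAdj i j := (dist_map_fccRef_eq_two_iff A i j).1 hxy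
  have hik : fccAdj i k := (dist_map_fccRef_eq_two_iff A i k).1 hxz
  have hjk : fccAdj j k := (dist_map_fccRef_eq_two_iff A j k).1 hyz
  have hij' : fccAdj i' j' := (dist_map_fccRef_eq_two_iff B i' j').1 (by
    dsimp only at hi' hj'; rw [hi', hj']; exact hxy)
  have hik' : fccAdj i' k' := (dist_map_fccRef_eq_two_iff B i' k').1 (by
    dsimp only at hi' hk'; rw [hi', hk']; exact hxz)
  have hjk' : fccAdj j' k' := (dist_map_fccRef_eq_two_iff B j' k').1 (by
    dsimp only at hj' hk'; rw [hj', hk']; exact hyz)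
  exact Set.Subset.antisymm
    (range_fccRef_subset_of_triangle hij hik hjk hij' hik' hjk' hi'.symm hj'.symm hk'.symm)
    (range_fccRef_subset_of_triangle hij' hik' hjk' hij hik hjk hi' hj' hk')

/-- **Two FCC-arranged sets sharing a square corner are equal**: `x ~ y`, `x ~ z` (distance `2`)
and `dist(y, z)² = 8` (so `x, y, z` are three corners of a square face). [folklore] -/
theorem eq_of_isArrangedIn_fcc_of_corner {T₁ T₂ : Set (EuclideanSpace ℝ (Fin 3))}
    (h₁ : IsArrangedIn T₁ fccKissingPattern) (h₂ : IsArrangedIn T₂ fccKissingPattern)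
    {x y z : EuclideanSpace ℝ (Fin 3)} (hx₁ : x ∈ T₁) (hy₁ : y ∈ T₁) (hz₁ : z ∈ T₁)
    (hx₂ : x ∈ T₂) (hy₂ : y ∈ T₂) (hz₂ : z ∈ T₂)
    (hxy : dist x y = 2) (hxz : dist x z = 2) (hyz : dist y z ^ 2 = 8) : T₁ = T₂ := by
  obtain ⟨A, rfl⟩ := isArrangedIn_fcc_iff_range.1 h₁
  obtain ⟨B, rfl⟩ := isArrangedIn_fcc_iff_range.1 h₂
  obtain ⟨i, rfl⟩ := hx₁
  obtain ⟨j, rfl⟩ := hy₁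
  obtain ⟨k, rfl⟩ := hz₁
  obtain ⟨i', hi'⟩ := hx₂
  obtain ⟨j', hj'⟩ := hy₂
  obtain ⟨k', hk'⟩ := hz₂
  have hij : fccAdj i j := (dist_map_fccRef_eq_two_iff A i j).1 hxy
  have hik : fccAdj i k := (dist_map_fccRef_eq_two_iff A i k).1 hxz
  have hjk : sqNormInt (fccTab j - fccTab k) = 4 := (dist_map_fccRef_sq_eq_eight_iff A j k).1 hyz
  have hij' : fccAdj i' j' := (dist_map_fccRef_eq_two_iff B i' j').1 (by
    dsimp only at hi' hj'; rw [hi', hj']; exact hxy)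
  have hik' : fccAdj i' k' := (dist_map_fccRef_eq_two_iff B i' k').1 (by
    dsimp only at hi' hk'; rw [hi', hk']; exact hxz)
  have hjk' : sqNormInt (fccTab j' - fccTab k') = 4 := (dist_map_fccRef_sq_eq_eight_iff B j' k').1 (by
    dsimp only at hj' hk'; rw [hj', hk']; exact hyz)
  exact Set.Subset.antisymm
    (range_fccRef_subset_of_corner hij hik hjk hij' hik' hjk' hi'.symm hj'.symm hk'.symm)
    (range_fccRef_subset_of_corner hij' hik' hjk' hij hik hjk hi' hj' hk')

end Summit.AtomisticToContinuum.Crystallization.Theorems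

end
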